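import Summits.AtomisticToContinuum.FouriersLaw.Theses.OddSectorIrreversibility
import Summits.AtomisticToContinuum.FouriersLaw.Theorems.ConductanceLowerBound.Negative.NotInsulatorReduction

/-!
# `BoundedResponseConverges` / Negative: oscillation is excluded by superadditive resistance

Negative knowledge / kill criterion for crux `stmt-AtomisticToContinuum-9141`
(`OddSectorIrreversibility.BoundedResponseConverges`: bounded response ⇒ `D_N → k > 0`), crux
disprover, cycle 1 (2026-08-16). Of the crux's two printed failure modes — perfect insulator
`D_N → 0`, and bounded OSCILLATION in `N` — the second is reduced here to a violation of the
junction-locality bet (A) `JunctionLocality.SuperadditiveResistance` (item 11748):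

* `boundedResponseConverges_tendsto_div_of_superadditive` — superadditive Fekete lemma on the index
  semigroup `{n ≥ 2}` with bounded slopes: `a (n+m) ≥ a n + a m` (`n, m ≥ 2`) and `a n / n ≤ M` give
  `a n / n → sup_{n ≥ 2} a n / n` (real variable; Euclidean decomposition `n = q m + r`, `2 ≤ r ≤ m+1`,
  iterated superadditivity `conductanceLowerBound_iter_superadditive`).
* `boundedResponseConverges_seq_tendsto_zero_or_pos` — if `D n > 0` (`n ≥ 2`), `R n = (n-1)/D n` is
  superadditive up to `C` on `{n, m ≥ 2}` and `D n ≤ B`, then `D → 0` OR `D → k > 0` (via the sibling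
  dichotomy `conductanceLowerBound_seq_insulator_or_lowerBound` and the Fekete lemma applied to
  `R n - C`, whose slopes are bounded once `D n ≥ c` eventually; `k = 1/sup ≥ 1/B`-type bookkeeping).
* `boundedResponseConverges_response_tendsto_zero_or_pos`, `boundedResponseConverges_iff_noBoundedInsulator`
  — granted (A) and (P) `JunctionLocality.PositiveConductance`, every bounded response sequence of
  `pinnedChain` converges, and the crux is EQUIVALENT to "no admissible parameter point has a bounded
  response sequence tending to `0`": a refutation compatible with (A) is exactly a perfect-insulator
  theorem for the clean pinned anharmonic chain, for which no mechanism is in print.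
Nothing here closes an item.
-/

noncomputable section

namespace Summit.AtomisticToContinuum.FouriersLaw.Theorems

open MeasureTheory Filter Topology
open Literature.MathematicalPhysics.KineticTheory.HeatConduction
open Summit.AtomisticToContinuum.FouriersLaw.Theses.OddSectorIrreversibility (BoundedResponseConverges)
open Summit.AtomisticToContinuum.FouriersLaw.Theses.JunctionLocality (SuperadditiveResistance)

/-- Euclidean decomposition adapted to the index semigroup `{n ≥ 2}`: for `n, m ≥ 2`,
`n = q m + r` with `2 ≤ r ≤ m + 1`. -/
theorem boundedResponseConverges_fekete_decomp {n m : ℕ} (hn : 2 ≤ n) (hm : 2 ≤ m) :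
    ∃ q r : ℕ, n = q * m + r ∧ 2 ≤ r ∧ r ≤ m + 1 := by
  refine ⟨(n - 2) / m, 2 + (n - 2) % m, ?_, by omega, ?_⟩
  · have h := Nat.div_add_mod (n - 2) m
    have h' : (n - 2) / m * m + (2 + (n - 2) % m) = m * ((n - 2) / m) + (n - 2) % m + 2 := by ring
    omega
  · have : (n - 2) % m < m := Nat.mod_lt _ (by omega)
    omega

/-- **Superadditive Fekete lemma on `{n ≥ 2}` with bounded slopes**: if `a (n+m) ≥ a n + a m` for
`n, m ≥ 2` and `a n / n ≤ M` for `n ≥ 2`, then `a n / n` converges to `s = sup_{n ≥ 2} a n / n`, and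
`a n / n ≤ s` for all `n ≥ 2`. [folklore] -/
theorem boundedResponseConverges_tendsto_div_of_superadditive {a : ℕ → ℝ}
    (h : ∀ n m : ℕ, 2 ≤ n → 2 ≤ m → a n + a m ≤ a (n + m))
    {M : ℝ} (hM : ∀ n : ℕ, 2 ≤ n → a n / n ≤ M) :
    ∃ s : ℝ, Tendsto (fun n : ℕ => a n / n) atTop (𝓝 s) ∧ ∀ n : ℕ, 2 ≤ n → a n / n ≤ s := by
  -- the sup over `n ≥ 2`
  set S : Set ℝ := (fun n : ℕ => a n / n) '' {n : ℕ | 2 ≤ n} with hS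
  have hSne : S.Nonempty :=
    ⟨_, Set.mem_image_of_mem _ (show (2 : ℕ) ∈ {n : ℕ | 2 ≤ n} from le_refl 2)⟩
  have hSbdd : BddAbove S := ⟨M, by
    rintro _ ⟨n, hn, rfl⟩
    exact hM n hn⟩
  set s := sSup S with hs
  have hle : ∀ n : ℕ, 2 ≤ n → a n / n ≤ s := fun n hn => le_csSup hSbdd ⟨n, hn, rfl⟩
  refine ⟨s, ?_, hle⟩
  rw [Metric.tendsto_atTop]
  intro ε hε
  -- a good scale `m ≥ 2` with `a m / m > s - ε/2`
  obtain ⟨_, ⟨m, hm', rfl⟩, hmgt⟩ := exists_lt_of_lt_csSup hSne (by linarith : s - ε / 2 < s)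
  have hm : 2 ≤ m := hm'
  have hm0 : (0 : ℝ) < m := by exact_mod_cast (by omega : 0 < m)
  set A := a m / m with hA
  -- error constant `K ≥ r |A| + |a r|` for every `r ≤ m + 1`
  set K : ℝ := ((m : ℝ) + 1) * |A| + ∑ r ∈ Finset.range (m + 2), |a r| with hK
  have hK0 : 0 ≤ K := by positivity
  -- choose `N₀` with `K / n < ε / 2` for `n ≥ N₀`
  obtain ⟨N₀, hN₀⟩ := exists_nat_gt (2 * K / ε)
  refine ⟨max N₀ 2, fun n hn => ?_⟩
  have hn2 : 2 ≤ n := le_of_max_le_right hn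
  have hnN : N₀ ≤ n := le_of_max_le_left hn
  have hn0 : (0 : ℝ) < n := by exact_mod_cast (by omega : 0 < n)
  -- decompose `n = q m + r`
  obtain ⟨q, r, hnqr, hr2, hrm⟩ := boundedResponseConverges_fekete_decomp hn2 hm
  have hiter := conductanceLowerBound_iter_superadditive h hm hr2 q
  rw [← hnqr] at hiter
  -- `q * a m = (n - r) * A`
  have hqm : (q : ℝ) * m = n - r := by
    have : ((q * m + r : ℕ) : ℝ) = n := by rw [hnqr]
    push_cast at this
    linarith
  have ham : a m = m * A := by
    rw [hA]; field_simp
  have hmain : (n : ℝ) * A - ((r : ℝ) * |A| + |a r|) ≤ a n := by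
    have h1 : (q : ℝ) * a m = ((n : ℝ) - r) * A := by rw [ham, ← mul_assoc, hqm]
    have h2 : (r : ℝ) * A ≤ (r : ℝ) * |A| := mul_le_mul_of_nonneg_left (le_abs_self _) (by positivity)
    have h3 : -a r ≤ |a r| := neg_le_abs _
    nlinarith [hiter, h1, h2, h3]
  have hrle : (r : ℝ) ≤ m + 1 := by exact_mod_cast hrm
  have hKr : (r : ℝ) * |A| + |a r| ≤ K := by
    have h1 : (r : ℝ) * |A| ≤ ((m : ℝ) + 1) * |A| := mul_le_mul_of_nonneg_right hrle (abs_nonneg _)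
    have h2 : |a r| ≤ ∑ r ∈ Finset.range (m + 2), |a r| :=
      Finset.single_le_sum (f := fun r => |a r|) (fun i _ => abs_nonneg _)
        (Finset.mem_range.2 (by omega))
    linarith
  -- lower bound `a n / n ≥ A - K / n`
  have hlow : A - K / n ≤ a n / n := by
    rw [le_div_iff₀ hn0, sub_mul, div_mul_cancel₀ _ hn0.ne']
    linarith
  -- `K / n < ε / 2`
  have hKn : K / n < ε / 2 := by
    have hN₀' : 2 * K / ε < n := lt_of_lt_of_le hN₀ (by exact_mod_cast hnN)
    rw [div_lt_iff₀ hn0]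
    rw [div_lt_iff₀ hε] at hN₀'
    linarith
  have hup := hle n hn2
  rw [Real.dist_eq, abs_lt]
  constructor <;> linarith

/-- **Convergence dichotomy at the sequence level**: if `D n > 0` (`n ≥ 2`), the resistances
`R n = (n-1)/D n` are superadditive up to `C` on `{n, m ≥ 2}`, and `D n ≤ B`, then EITHER `D → 0`
OR `D → k` for some `k > 0`. In particular `D` converges: bounded OSCILLATION is excluded by
quasi-superadditivity of the resistance. [folklore] -/
theorem boundedResponseConverges_seq_tendsto_zero_or_pos {D : ℕ → ℝ} {C B : ℝ}
    (hpos : ∀ N : ℕ, 2 ≤ N → 0 < D N)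
    (hsup : ∀ N M : ℕ, 2 ≤ N → 2 ≤ M →
      ((N : ℝ) - 1) / D N + ((M : ℝ) - 1) / D M - C ≤ ((N : ℝ) + (M : ℝ) - 1) / D (N + M))
    (hbdd : ∀ N : ℕ, 2 ≤ N → D N ≤ B) :
    Tendsto D atTop (𝓝 0) ∨ ∃ k : ℝ, 0 < k ∧ Tendsto D atTop (𝓝 k) := by
  rcases conductanceLowerBound_seq_insulator_or_lowerBound hpos hsup with h0 | ⟨c, hc, N₁, hN₁⟩
  · exact Or.inl h0
  right
  -- the superadditive sequence `a n = R n - C`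
  set a : ℕ → ℝ := fun N => ((N : ℝ) - 1) / D N - C with ha
  have hsa : ∀ n m : ℕ, 2 ≤ n → 2 ≤ m → a n + a m ≤ a (n + m) := by
    intro n m hn hm
    have := hsup n m hn hm
    simp only [ha]
    push_cast
    linarith
  have hB : 0 < B := lt_of_lt_of_le (hpos 2 le_rfl) (hbdd 2 le_rfl)
  -- slopes are bounded above: finitely many `n < N₁`, and `R n / n ≤ 1/c` beyond
  set M : ℝ := (∑ n ∈ Finset.range N₁, |a n / n|) + (1 / c + |C|) with hM
  have hslope : ∀ n : ℕ, 2 ≤ n → a n / n ≤ M := by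
    intro n hn
    have hn0 : (0 : ℝ) < n := by exact_mod_cast (by omega : 0 < n)
    by_cases hlt : n < N₁
    · have h1 : a n / n ≤ |a n / n| := le_abs_self _
      have h2 : |a n / n| ≤ ∑ k ∈ Finset.range N₁, |a k / k| :=
        Finset.single_le_sum (f := fun k => |a k / k|) (fun i _ => abs_nonneg _)
          (Finset.mem_range.2 hlt)
      have h3 : (0 : ℝ) ≤ 1 / c + |C| := by positivity
      linarith
    · push Not at hlt
      have hDn : c ≤ D n := hN₁ n hlt
      have hDpos : 0 < D n := hpos n hn
      have hR : ((n : ℝ) - 1) / D n ≤ ((n : ℝ) - 1) / c :=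
        div_le_div_of_nonneg_left (by linarith [show (2 : ℝ) ≤ n by exact_mod_cast hn]) hc hDn
      have h1 : a n / n ≤ (((n : ℝ) - 1) / c + |C|) / n := by
        apply div_le_div_of_nonneg_right _ hn0.le
        simp only [ha]
        linarith [neg_le_abs C, le_abs_self C]
      have h2 : (((n : ℝ) - 1) / c + |C|) / n ≤ 1 / c + |C| := by
        rw [div_le_iff₀ hn0]
        have : ((n : ℝ) - 1) / c ≤ n / c := div_le_div_of_nonneg_right (by linarith) hc.le
        have h1n : (1 : ℝ) ≤ n := by exact_mod_cast (by omega : 1 ≤ n)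
        have : n / c = 1 / c * n := by ring
        nlinarith [abs_nonneg C]
      have h0 : (0 : ℝ) ≤ ∑ k ∈ Finset.range N₁, |a k / k| :=
        Finset.sum_nonneg fun i _ => abs_nonneg _
      linarith
  obtain ⟨s, hs, hsle⟩ := boundedResponseConverges_tendsto_div_of_superadditive hsa hslope
  -- `s ≥ 1/B > 0`: `a n / n ≥ (n-1)/(B n) - C/n → 1/B`
  have hs_ge : 1 / B ≤ s := by
    have hlow : Tendsto (fun n : ℕ => ((n : ℝ) - 1) / (B * n) - C / n) atTop (𝓝 (1 / B)) := by
      have h1 : Tendsto (fun n : ℕ => ((n : ℝ) - 1) / (B * n)) atTop (𝓝 (1 / B)) := by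
        have e : (fun n : ℕ => ((n : ℝ) - 1) / (B * n)) =ᶠ[atTop]
            fun n : ℕ => 1 / B - 1 / B * (n : ℝ)⁻¹ := by
          filter_upwards [eventually_ge_atTop 1] with n hn
          have hn0 : (n : ℝ) ≠ 0 := by exact_mod_cast (by omega : n ≠ 0)
          field_simp
        rw [tendsto_congr' e]
        have := ((tendsto_inv_atTop_nhds_zero_nat (𝕜 := ℝ)).const_mul (1 / B)).const_sub (1 / B)
        simpa using this
      have h2 : Tendsto (fun n : ℕ => C / (n : ℝ)) atTop (𝓝 0) := tendsto_const_div_atTop_nhds_zero_nat C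
      simpa using h1.sub h2
    refine le_of_tendsto_of_tendsto hlow hs ?_
    filter_upwards [eventually_ge_atTop 2] with n hn
    have hn0 : (0 : ℝ) < n := by exact_mod_cast (by omega : 0 < n)
    have hDpos : 0 < D n := hpos n hn
    have hR : ((n : ℝ) - 1) / B ≤ ((n : ℝ) - 1) / D n :=
      div_le_div_of_nonneg_left (by linarith [show (2 : ℝ) ≤ n by exact_mod_cast hn]) hDpos
        (hbdd n hn)
    have : ((n : ℝ) - 1) / (B * n) - C / n = (((n : ℝ) - 1) / B - C) / n := by
      field_simp
    rw [this]
    apply div_le_div_of_nonneg_right _ hn0.le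
    simp only [ha]
    linarith
  have hs0 : 0 < s := lt_of_lt_of_le (by positivity) hs_ge
  -- `D n = ((n-1)/n) / (a n / n + C / n) → 1 / s`
  refine ⟨1 / s, by positivity, ?_⟩
  have hnum : Tendsto (fun n : ℕ => ((n : ℝ) - 1) / n) atTop (𝓝 1) := by
    have e : (fun n : ℕ => ((n : ℝ) - 1) / n) =ᶠ[atTop] fun n : ℕ => 1 - (n : ℝ)⁻¹ := by
      filter_upwards [eventually_ge_atTop 1] with n hn
      have hn0 : (n : ℝ) ≠ 0 := by exact_mod_cast (by omega : n ≠ 0)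
      field_simp
    rw [tendsto_congr' e]
    simpa using (tendsto_inv_atTop_nhds_zero_nat (𝕜 := ℝ)).const_sub 1
  have hden : Tendsto (fun n : ℕ => a n / n + C / n) atTop (𝓝 s) := by
    simpa using hs.add (tendsto_const_div_atTop_nhds_zero_nat C)
  have hq : Tendsto (fun n : ℕ => ((n : ℝ) - 1) / n / (a n / n + C / n)) atTop (𝓝 (1 / s)) :=
    hnum.div hden hs0.ne'
  refine hq.congr' ?_
  filter_upwards [eventually_ge_atTop 2] with n hn
  have hn0 : (n : ℝ) ≠ 0 := by exact_mod_cast (by omega : n ≠ 0)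
  have hn1 : (n : ℝ) - 1 ≠ 0 := by
    have : (2 : ℝ) ≤ n := by exact_mod_cast hn
    linarith
  have hD0 : D n ≠ 0 := (hpos n hn).ne'
  simp only [ha]
  field_simp
  have e : (n : ℝ) - 1 - D n * C + D n * C = n - 1 := by ring
  rw [e, div_self hn1]


/-- **Under (A) `SuperadditiveResistance` + (P) `PositiveConductance` every BOUNDED response sequence
of the conjunct's chain converges — to `0` or to a positive conductivity.** [folklore] -/
theorem boundedResponseConverges_response_tendsto_zero_or_pos (hA : SuperadditiveResistance)
    (hP : Theses.JunctionLocality.PositiveConductance) {ω₂ lam β γ : ℝ} (hω : 0 < ω₂) (hl : 0 < lam)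
    (hβ : 0 < β) (hγ : 0 < γ)
    (hu : ∀ (N : ℕ) (T_L T_R : ℝ), 0 < T_L → 0 < T_R → ∀ μ ν : Measure (PhaseSpace N),
      (pinnedChain ω₂ lam β γ).IsSteadyState N T_L T_R μ →
        (pinnedChain ω₂ lam β γ).IsSteadyState N T_L T_R ν → μ = ν)
    {μ : (N : ℕ) → ℝ → ℝ → Measure (PhaseSpace N)}
    (hμ : ∀ (N : ℕ) (T_L T_R : ℝ), 0 < T_L → 0 < T_R →
      (pinnedChain ω₂ lam β γ).IsSteadyState N T_L T_R (μ N T_L T_R))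
    {T : ℝ} (hT : 0 < T) {D : ℕ → ℝ}
    (hD : ∀ N : ℕ, Tendsto (fun δ : ℝ =>
      (pinnedChain ω₂ lam β γ).totalCurrent (μ N (T + δ / 2) (T - δ / 2)) / δ) (𝓝[≠] 0) (𝓝 (D N)))
    (hB : BddAbove (Set.range fun N => |D N|)) :
    Tendsto D atTop (𝓝 0) ∨ ∃ k : ℝ, 0 < k ∧ Tendsto D atTop (𝓝 k) := by
  have hpos : ∀ N : ℕ, 2 ≤ N → 0 < D N := hP ω₂ lam β γ hω hl hβ hγ hu μ hμ T hT D hD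
  obtain ⟨C, hsup⟩ := hA ω₂ lam β γ hω hl hβ hγ hu μ hμ T hT D hD hpos
  obtain ⟨B, hBd⟩ := hB
  exact boundedResponseConverges_seq_tendsto_zero_or_pos hpos hsup
    (fun N _ => le_trans (le_abs_self _) (hBd ⟨N, rfl⟩))

/-- **KILL CRITERION under (A)+(P): the crux ⟺ no bounded-response perfect insulator.** Granted
`SuperadditiveResistance` and `PositiveConductance` (route `JunctionLocality`),
`BoundedResponseConverges` is EQUIVALENT to "no admissible parameter point has a bounded response
sequence tending to `0`"; bounded oscillation in `N` is excluded by (A). [folklore] -/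
theorem boundedResponseConverges_iff_noBoundedInsulator (hA : SuperadditiveResistance)
    (hP : Theses.JunctionLocality.PositiveConductance) :
    BoundedResponseConverges ↔
      ∀ ω₂ lam β γ : ℝ, 0 < ω₂ → 0 < lam → 0 < β → 0 < γ →
        (∀ (N : ℕ) (T_L T_R : ℝ), 0 < T_L → 0 < T_R → ∀ μ ν : Measure (PhaseSpace N),
          (pinnedChain ω₂ lam β γ).IsSteadyState N T_L T_R μ →
            (pinnedChain ω₂ lam β γ).IsSteadyState N T_L T_R ν → μ = ν) →
        ∀ μ : (N : ℕ) → ℝ → ℝ → Measure (PhaseSpace N),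
          (∀ (N : ℕ) (T_L T_R : ℝ), 0 < T_L → 0 < T_R →
            (pinnedChain ω₂ lam β γ).IsSteadyState N T_L T_R (μ N T_L T_R)) →
          ∀ T : ℝ, 0 < T → ∀ D : ℕ → ℝ,
            (∀ N : ℕ, Tendsto (fun δ : ℝ =>
              (pinnedChain ω₂ lam β γ).totalCurrent (μ N (T + δ / 2) (T - δ / 2)) / δ)
              (𝓝[≠] 0) (𝓝 (D N))) →
            BddAbove (Set.range fun N => |D N|) → ¬ Tendsto D atTop (𝓝 0) := by
  constructor
  · intro h ω₂ lam β γ hω hl hβ hγ hu μ hμ T hT D hD hB h0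
    obtain ⟨k, hk, hlim⟩ := h ω₂ lam β γ hω hl hβ hγ hu μ hμ T hT D hD hB
    exact hk.ne' (tendsto_nhds_unique hlim h0)
  · intro h ω₂ lam β γ hω hl hβ hγ hu μ hμ T hT D hD hB
    rcases boundedResponseConverges_response_tendsto_zero_or_pos hA hP hω hl hβ hγ hu hμ hT hD hB
      with h0 | hk
    · exact absurd h0 (h ω₂ lam β γ hω hl hβ hγ hu μ hμ T hT D hD hB)
    · exact hk

end Summit.AtomisticToContinuum.FouriersLaw.Theorems

end
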